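import Summits.AnomalousDissipation.AnomalousDissipation.Theorems.MomentParityQuarticGateAxialQuadCentre
import Summits.AnomalousDissipation.AnomalousDissipation.Theorems.MomentParityQuarticGateAxialQuadOffC

/-!
# Axial quadratic rigidity (stub S2q of line `axis-sectors`, crux `MomentParity.QuarticGate`):
# the algebraic core

**The block classification.** A family of complex `3 × 3` blocks `Q a b` (`a, b ∈ ℤ³`) — the Hessian
blocks of a quadratic observable in the complexified Fourier amplitudes of level-`N` fields — that is
supported in the punctured ball `0 < |a|², |b|² ≤ N²`, symmetric (`Q b a = (Q a b)ᵀ`), transverse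
(`aᵀ Q a b = 0`, `Q a b b = 0`), AXIAL (nonzero only for `a + b ∈ ℤ e₁`) and satisfies the
polarised single-triad identity `(POL)` of a quadratic Casimir of ball-truncated Euler, is, for
`N ≥ 2`, the block family of `α E + β H`: `Q (-b) b = α + β b×` on `b⊥` and all other blocks vanish.
Assembled from `centre_pinned` (the centre sector) and `offcentre` (the off-centre axial sectors).
-/

namespace Summit.AnomalousDissipation.AnomalousDissipation.Theorems.MomentParityQuarticGate.AxialQuad

open Matrix

-- `Summit.<Summit>.<Problem>` is the tree's mandated summit-side namespace (CONVENTIONS §2); for this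
-- single-conjunct summit the two coincide, so the duplicate is deliberate.
set_option linter.dupNamespace false

/-- **THE ALGEBRAIC CORE OF AXIAL QUADRATIC RIGIDITY.** See the module docstring. [folklore] -/
theorem axialQuad_core {N : ℕ} (hN : 2 ≤ N)
    (Q : (Fin 3 → ℤ) → (Fin 3 → ℤ) → Matrix (Fin 3) (Fin 3) ℂ)
    (hsupp : ∀ a b : Fin 3 → ℤ, ¬ ((a ≠ 0 ∧ a ⬝ᵥ a ≤ ((N : ℕ) : ℤ) ^ 2) ∧
      (b ≠ 0 ∧ b ⬝ᵥ b ≤ ((N : ℕ) : ℤ) ^ 2)) → Q a b = 0)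
    (hsymm : ∀ a b, Q b a = (Q a b)ᵀ) (hrow : ∀ a b, (fun i : Fin 3 => (((a : Fin 3 → ℤ) i : ℤ) : ℂ)) ᵥ* Q a b = 0)
    (hcol : ∀ a b, Q a b *ᵥ (fun i : Fin 3 => (((b : Fin 3 → ℤ) i : ℤ) : ℂ)) = 0)
    (haxial : ∀ a b, Q a b ≠ 0 → (a + b) 0 = 0 ∧ (a + b) 2 = 0)
    (hpol : ∀ (k₁ k₂ k₃ : Fin 3 → ℤ) (v₁ v₂ v₃ : Fin 3 → ℂ),
      (k₁ ≠ 0 ∧ k₁ ⬝ᵥ k₁ ≤ ((N : ℕ) : ℤ) ^ 2) → (k₂ ≠ 0 ∧ k₂ ⬝ᵥ k₂ ≤ ((N : ℕ) : ℤ) ^ 2) →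
      (k₃ ≠ 0 ∧ k₃ ⬝ᵥ k₃ ≤ ((N : ℕ) : ℤ) ^ 2) →
      v₁ ⬝ᵥ (fun i : Fin 3 => (((k₁ : Fin 3 → ℤ) i : ℤ) : ℂ)) = 0 → v₂ ⬝ᵥ (fun i : Fin 3 => (((k₂ : Fin 3 → ℤ) i : ℤ) : ℂ)) = 0 → v₃ ⬝ᵥ (fun i : Fin 3 => (((k₃ : Fin 3 → ℤ) i : ℤ) : ℂ)) = 0 →
      ((v₁ ⬝ᵥ (fun i : Fin 3 => (((k₂ : Fin 3 → ℤ) i : ℤ) : ℂ))) • v₂ + (v₂ ⬝ᵥ (fun i : Fin 3 => (((k₁ : Fin 3 → ℤ) i : ℤ) : ℂ))) • v₁) ⬝ᵥ (Q (k₁ + k₂) k₃ *ᵥ v₃) +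
        ((v₁ ⬝ᵥ (fun i : Fin 3 => (((k₃ : Fin 3 → ℤ) i : ℤ) : ℂ))) • v₃ + (v₃ ⬝ᵥ (fun i : Fin 3 => (((k₁ : Fin 3 → ℤ) i : ℤ) : ℂ))) • v₁) ⬝ᵥ (Q (k₁ + k₃) k₂ *ᵥ v₂) +
        ((v₂ ⬝ᵥ (fun i : Fin 3 => (((k₃ : Fin 3 → ℤ) i : ℤ) : ℂ))) • v₃ + (v₃ ⬝ᵥ (fun i : Fin 3 => (((k₂ : Fin 3 → ℤ) i : ℤ) : ℂ))) • v₂) ⬝ᵥ (Q (k₂ + k₃) k₁ *ᵥ v₁) = 0) :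
    ∃ α β : ℂ, ∀ (a b : Fin 3 → ℤ) (y : Fin 3 → ℂ), y ⬝ᵥ (fun i : Fin 3 => (((b : Fin 3 → ℤ) i : ℤ) : ℂ)) = 0 →
      Q a b *ᵥ y = if a + b = 0 ∧ (b ≠ 0 ∧ b ⬝ᵥ b ≤ ((N : ℕ) : ℤ) ^ 2)
        then α • y + β • ((fun i : Fin 3 => (((b : Fin 3 → ℤ) i : ℤ) : ℂ)) ⨯₃ y) else 0 := by
  refine ⟨Q ![-1, 0, 0] ![1, 0, 0] 1 1, Q ![-1, 0, 0] ![1, 0, 0] 2 1, fun a b y hy => ?_⟩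
  split_ifs with h
  · obtain ⟨hab, hb⟩ := h
    have ha : a = -b := eq_neg_of_add_eq_zero_left hab
    rw [ha]
    exact centre_pinned Q hN hsymm hrow hcol hpol b hb y hy
  · by_cases hab : a + b = 0
    · rw [hsupp a b fun hm => h ⟨hab, hm.2⟩, Matrix.zero_mulVec]
    · rw [offcentre Q hN hsupp hsymm hrow hcol hpol haxial a b hab, Matrix.zero_mulVec]

end Summit.AnomalousDissipation.AnomalousDissipation.Theorems.MomentParityQuarticGate.AxialQuad

namespace Summit.AnomalousDissipation.AnomalousDissipation.Theorems.MomentParityQuarticGate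

-- the summit-side namespace repeats `AnomalousDissipation` by the tree's convention
set_option linter.dupNamespace false in
/-- **Registered sub-goal `axialQuad_core` of stub S2q** (summary of this file): THE ALGEBRAIC CORE — an axial, supported, symmetric, transverse block family satisfying `(POL)` is the block family of `α E + β H`. [folklore] -/
theorem axialQuad_core : ∀ (N : ℕ), 2 ≤ N → ∀ (Q : ((Fin 3 → ℤ) → (Fin 3 → ℤ) → Matrix (Fin 3) (Fin 3) ℂ)), (∀ a b : Fin 3 → ℤ, ¬ (((a : Fin 3 → ℤ) ≠ 0 ∧ (a) ⬝ᵥ (a) ≤ ((N : ℕ) : ℤ) ^ 2) ∧ ((b : Fin 3 → ℤ) ≠ 0 ∧ (b) ⬝ᵥ (b) ≤ ((N : ℕ) : ℤ) ^ 2)) → Q a b = 0) → (∀ a b : Fin 3 → ℤ, Q b a = Matrix.transpose (Q a b)) → (∀ a b : Fin 3 → ℤ, Matrix.vecMul (fun i : Fin 3 => (((a : Fin 3 → ℤ) i : ℤ) : ℂ)) (Q a b) = 0) → (∀ a b : Fin 3 → ℤ, Matrix.mulVec (Q a b) (fun i : Fin 3 => (((b : Fin 3 → ℤ) i : ℤ)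 : ℂ)) = 0) → (∀ a b : Fin 3 → ℤ, Q a b ≠ 0 → (a + b) 0 = 0 ∧ (a + b) 2 = 0) → (∀ (k₁ k₂ k₃ : Fin 3 → ℤ) (v₁ v₂ v₃ : Fin 3 → ℂ), ((k₁ : Fin 3 → ℤ) ≠ 0 ∧ (k₁) ⬝ᵥ (k₁) ≤ ((N : ℕ) : ℤ) ^ 2) → ((k₂ : Fin 3 → ℤ) ≠ 0 ∧ (k₂) ⬝ᵥ (k₂) ≤ ((N : ℕ) : ℤ) ^ 2) → ((k₃ : Fin 3 → ℤ) ≠ 0 ∧ (k₃) ⬝ᵥ (k₃) ≤ ((N : ℕ) : ℤ) ^ 2) → v₁ ⬝ᵥ (fun i : Fin 3 => (((k₁ : Fin 3 → ℤ) i : ℤ) : ℂ)) = 0 → v₂ ⬝ᵥ (fun i : Fin 3 => (((k₂ : Fin 3 → ℤ) i : ℤ) : ℂ)) = 0 → v₃ ⬝ᵥ (fun i : Fin 3 => (((k₃ : Fin 3 → ℤ) i : ℤ) : ℂ)) = 0 → (((v₁) ⬝ᵥ (fun i : Fin 3 => (((k₂ : Fin 3 → ℤ) i : ℤ) : ℂ)))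 • (v₂) + ((v₂) ⬝ᵥ (fun i : Fin 3 => (((k₁ : Fin 3 → ℤ) i : ℤ) : ℂ))) • (v₁) : Fin 3 → ℂ) ⬝ᵥ (Matrix.mulVec (Q (k₁ + k₂) k₃) v₃) + (((v₁) ⬝ᵥ (fun i : Fin 3 => (((k₃ : Fin 3 → ℤ) i : ℤ) : ℂ))) • (v₃) + ((v₃) ⬝ᵥ (fun i : Fin 3 => (((k₁ : Fin 3 → ℤ) i : ℤ) : ℂ))) • (v₁) : Fin 3 → ℂ) ⬝ᵥ (Matrix.mulVec (Q (k₁ + k₃) k₂) v₂) + (((v₂) ⬝ᵥ (fun i : Fin 3 => (((k₃ : Fin 3 → ℤ) i : ℤ) : ℂ))) • (v₃) + ((v₃) ⬝ᵥ (fun i : Fin 3 => (((k₂ : Fin 3 → ℤ) i : ℤ) : ℂ))) • (v₂) : Fin 3 → ℂ) ⬝ᵥ (Matrix.mulVec (Q (k₂ + k₃) k₁) v₁) = 0) → ∃ α β : ℂ, ∀ (a b : Fin 3 → ℤ) (y : Fin 3 → ℂ), y ⬝ᵥ (fun i : Fin 3 => (((b : Fin 3 → ℤ) i : ℤ) : ℂ))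 = 0 → Matrix.mulVec (Q a b) y = if a + b = 0 ∧ ((b : Fin 3 → ℤ) ≠ 0 ∧ (b) ⬝ᵥ (b) ≤ ((N : ℕ) : ℤ) ^ 2) then α • y + β • (crossProduct (fun i : Fin 3 => (((b : Fin 3 → ℤ) i : ℤ) : ℂ)) y) else 0 :=
  fun _ hN Q hsupp hsymm hrow hcol hax hpol => AxialQuad.axialQuad_core hN Q hsupp hsymm hrow hcol hax hpol

end Summit.AnomalousDissipation.AnomalousDissipation.Theorems.MomentParityQuarticGate
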